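import Summits.Ventures.PercRepro.S1CoreCapSpreadChain
import Summits.Ventures.PercRepro.S1FiveCircuitChain

/-!
# PercRepro — THE FIVE-CIRCUITS THROUGH A POINT BY CONTRACTION: `#5circ(e) ≤ C(ν + 3, 4)` AT NULLITY `ν`, ON EVERY FINITE MATROID
(p1, gen 33)

`proofs/P1-S2-CORANK6.md` §4j. A five-circuit `C ∋ e` contracts to the four-circuit `C ∖ {e}` of `M ／ {e}`
(`Matroid.IsCircuit.contractElem_isCircuit`), injectively; `M ／ {e}` has the nullity of `M` when `e` is not a loop
(`(M ／ {e})✶ = M✶ ＼ {e}`, and `e` is not a coloop of `M✶`: p3's `dual_eRank_delete_singleton_add_one` on `M✶`); the landed count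
`ncard_circuits_le_choose_of_encard` (`s₄ ≤ C(ν + 3, 4)` on a matroid of nullity `ν`) then bounds the four-circuits of the
contraction. So **`#{C : five-circuit, e ∈ C} ≤ C(ν + 3, 4)`** — the first three entries `1, 5, 15` of the per-point `s₅` table at
nullity `1, 2, 3` (tight on `U_{4,5}`, `U_{4,6}`, `U_{4,7}`), with no core or spread hypothesis at all.
* `nullity_contract_singleton_of_not_isLoop`, **`ncard_fiveCircuitsThrough_le_choose`**,
  `ncard_fiveCircuitsThrough_le_one`, `ncard_fiveCircuitsThrough_le_five`, `ncard_fiveCircuitsThrough_le_fifteen`.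
Axioms: standard.
-/

open scoped Matroid

namespace PercRepro

namespace S1

open Set

variable {α : Type}

/-- **The contraction of a non-loop keeps the nullity**: `|E ∖ {e}| = r(M ／ {e}) + ν` when `|E| = r(M) + ν` and `e ∈ E` is not a loop. -/
theorem nullity_contract_singleton_of_not_isLoop (M : Matroid α) [M.Finite] {e : α} (heE : e ∈ M.E)
    (hel : ¬ M.IsLoop e) {d : ℕ} (hd : M.E.encard = M.eRank + d) :
    (M ／ {e}).E.encard = (M ／ {e}).eRank + d := by
  have heE' : e ∈ M✶.E := by rwa [Matroid.dual_ground]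
  have hnc : ¬ M✶.IsColoop e := by rwa [Matroid.dual_isColoop_iff_isLoop]
  have h1 := PercRepro.Matroid.dual_eRank_delete_singleton_add_one heE' hnc
  rw [Matroid.dual_delete_dual, Matroid.dual_dual] at h1
  -- h1 : (M ／ {e}).eRank + 1 = M.eRank
  have hE : (M ／ {e}).E.encard + 1 = M.E.encard := by
    rw [Matroid.contract_ground]
    exact Set.encard_sdiff_singleton_add_one heE
  have h2 : (M ／ {e}).E.encard + 1 = ((M ／ {e}).eRank + d) + 1 := by
    rw [hE, hd, ← h1]; ring
  exact WithTop.add_right_cancel WithTop.one_ne_top h2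

/-- **The five-circuits through a point are at most `C(ν + 3, 4)`** on a finite matroid of nullity `ν`: they contract to distinct
four-circuits of `M ／ {e}`, a matroid of the same nullity. -/
theorem ncard_fiveCircuitsThrough_le_choose (M : Matroid α) [M.Finite] {d : ℕ} (hd : M.E.encard = M.eRank + d) (e : α) :
    {C : Set α | M.IsCircuit C ∧ C.ncard = 5 ∧ e ∈ C}.ncard ≤ (d + 3).choose 4 := by
  classical
  set S₁ := {C : Set α | M.IsCircuit C ∧ C.ncard = 5 ∧ e ∈ C} with hS₁
  by_cases hempty : S₁ = ∅
  · rw [hempty, ncard_empty]; exact Nat.zero_le _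
  obtain ⟨C₀, hC₀⟩ := nonempty_iff_ne_empty.2 hempty
  have heE : e ∈ M.E := hC₀.1.subset_ground hC₀.2.2
  have hel : ¬ M.IsLoop e := by
    intro hl
    have h5 := hC₀.2.1
    rw [hl.eq_of_isCircuit_mem hC₀.1 hC₀.2.2, ncard_singleton] at h5
    exact absurd h5 (by norm_num)
  have hdN := nullity_contract_singleton_of_not_isLoop M heE hel hd
  set S₂ := {C : Set α | (M ／ {e}).IsCircuit C ∧ C.ncard = 3 + 1} with hS₂
  have hS₂fin : S₂.Finite :=
    (M ／ {e}).ground_finite.finite_subsets.subset (fun C hC => hC.1.subset_ground)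
  have hmap : ∀ C ∈ S₁, C \ {e} ∈ S₂ := by
    intro C hC
    have hCfin : C.Finite := M.ground_finite.subset hC.1.subset_ground
    have hnt : C.Nontrivial := by
      have : Finite C := hCfin.to_subtype
      rw [← Set.one_lt_ncard_iff_nontrivial, hC.2.1]; norm_num
    refine ⟨hC.1.contractElem_isCircuit hnt hC.2.2, ?_⟩
    rw [Set.ncard_sdiff_singleton_of_mem hC.2.2, hC.2.1]
  have hinj : Set.InjOn (fun C : Set α => C \ {e}) S₁ := by
    intro C hC C' hC' h
    simp only at h
    have h1 : C = insert e (C \ {e}) := by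
      rw [Set.insert_sdiff_singleton, Set.insert_eq_of_mem hC.2.2]
    have h2 : C' = insert e (C' \ {e}) := by
      rw [Set.insert_sdiff_singleton, Set.insert_eq_of_mem hC'.2.2]
    rw [h1, h2, h]
  calc S₁.ncard ≤ S₂.ncard := Set.ncard_le_ncard_of_injOn _ hmap hinj hS₂fin
    _ ≤ (d + 3).choose (3 + 1) := PercRepro.Matroid.ncard_circuits_le_choose_of_encard (M ／ {e}) hdN 3

/-- At nullity `1`: at most `1` five-circuit through a point. -/
theorem ncard_fiveCircuitsThrough_le_one (M : Matroid α) [M.Finite] (hd : M.E.encard = M.eRank + 1) (e : α) :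
    {C : Set α | M.IsCircuit C ∧ C.ncard = 5 ∧ e ∈ C}.ncard ≤ 1 :=
  ncard_fiveCircuitsThrough_le_choose M (d := 1) (by exact_mod_cast hd) e

/-- At nullity `2`: at most `5` five-circuits through a point (`U_{4,6}`). -/
theorem ncard_fiveCircuitsThrough_le_five (M : Matroid α) [M.Finite] (hd : M.E.encard = M.eRank + 2) (e : α) :
    {C : Set α | M.IsCircuit C ∧ C.ncard = 5 ∧ e ∈ C}.ncard ≤ 5 :=
  ncard_fiveCircuitsThrough_le_choose M (d := 2) (by exact_mod_cast hd) e

/-- At nullity `3`: at most `15` five-circuits through a point (`U_{4,7}`). -/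
theorem ncard_fiveCircuitsThrough_le_fifteen (M : Matroid α) [M.Finite] (hd : M.E.encard = M.eRank + 3) (e : α) :
    {C : Set α | M.IsCircuit C ∧ C.ncard = 5 ∧ e ∈ C}.ncard ≤ 15 :=
  ncard_fiveCircuitsThrough_le_choose M (d := 3) (by exact_mod_cast hd) e

end S1

end PercRepro
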